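import Literature.Barriers.Parity.SiegelZeroDichotomyChowlaStep5
import HarnessLib

/-!
# Tao–Teräväinen 2022, §8 (`k = 2`): absorption of the error terms into `1/log^{1/20} η`

Topic `Literature/Barriers/Parity`, sub-namespace `TaoTeravainen`; generic bookkeeping for the final
assembly of `Literature.Barriers.Parity.TaoTeravainen2021_prop72_81_pair` (T. Tao, J. Teräväinen, *The
Hardy–Littlewood–Chowla conjecture in the presence of a Siegel zero*, J. London Math. Soc. (2) 106 (2022),
arXiv:2109.06291): the conventions of §2 ("we allow implied constants to depend on `ε₀`"; (1.4)
`η ≪_ε q^ε`; the `≈` notation hiding `O(log^{-c} η)`) by which every error of the shape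
`log^{O(1)} x · x^{-δ}`, `q^{-δ} log^{O(1)} x` or `log^{-7/10} x` is `≪ log^{-1/20} η` on the range
`q^{20.5} ≤ x ≤ q^{√η}` over Siegel zeros. Everything here is PROVED:

* `one_add_log_pow_le_rpow` — `(1 + log x)^k ≤ (1 + k/δ)^k x^δ` for `x ≥ 1`;
* `rpow_neg_le_of_le_rpow` — `x^{-a} ≤ q^{-20.5 a}` when `q^{20.5} ≤ x`;
* `exists_log_conductor_rpow_neg_le` — `(log q)^{-7/10} ≤ K/log^{1/20} η` over Siegel zeros;
* `inv_log_rpow_tenth_le` — `1/log^{1/10} η ≤ 1/log^{1/20} η` (`η ≥ 10`);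
* `exists_rpow_neg_le_div_twentieth` — `q^{-ε} ≤ K/log^{1/20} η`. [cite: TaoTeravainen2021, §2 (asymptotic
  notation) and (1.4)]
-/

noncomputable section

open Real

namespace Literature.Barriers.Parity

namespace TaoTeravainen

/-- **`(1 + log x)^k ≤ (1 + k/δ)^k · x^δ`** for `x ≥ 1`, `δ > 0`. [folklore] -/
theorem one_add_log_pow_le_rpow {x δ : ℝ} (hx : 1 ≤ x) (hδ : 0 < δ) (k : ℕ) :
    (1 + Real.log x) ^ k ≤ (1 + k / δ) ^ k * x ^ δ := by
  rcases Nat.eq_zero_or_pos k with rfl | hk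
  · simp only [pow_zero, one_mul]; exact Real.one_le_rpow hx hδ.le
  have hx0 : 0 < x := by linarith
  have hlog0 : 0 ≤ Real.log x := Real.log_nonneg hx
  -- `log x ≤ x^{δ/k}/(δ/k)`
  have hδk : 0 < δ / k := by positivity
  have h1 : Real.log x ≤ x ^ (δ / k) / (δ / k) := Real.log_le_rpow_div hx0.le hδk
  have hxpow1 : 1 ≤ x ^ (δ / k) := Real.one_le_rpow hx hδk.le
  have h2 : 1 + Real.log x ≤ (1 + k / δ) * x ^ (δ / k) := by
    rw [div_div_eq_mul_div] at h1
    have : x ^ (δ / k) * k / δ = k / δ * x ^ (δ / k) := by ring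
    rw [this] at h1
    have hk0 : (0 : ℝ) ≤ k / δ := by positivity
    nlinarith
  calc (1 + Real.log x) ^ k ≤ ((1 + k / δ) * x ^ (δ / k)) ^ k := pow_le_pow_left₀ (by positivity) h2 k
    _ = (1 + k / δ) ^ k * (x ^ (δ / k)) ^ k := mul_pow _ _ _
    _ = (1 + k / δ) ^ k * x ^ δ := by
        rw [← Real.rpow_natCast (x ^ (δ / k)) k, ← Real.rpow_mul hx0.le]
        congr 2; field_simp

/-- **`x^{-a} ≤ q^{-(41/2) a}`** when `q^{41/2} ≤ x` (`a ≥ 0`, `q ≥ 1`). [folklore] -/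
theorem rpow_neg_le_of_le_rpow {x q a : ℝ} (hq : 1 ≤ q) (hx : q ^ ((41 : ℝ) / 2) ≤ x) (ha : 0 ≤ a) :
    x ^ (-a) ≤ q ^ (-((41 : ℝ) / 2 * a)) := by
  have hq0 : 0 < q := by linarith
  have hqx0 : 0 < q ^ ((41 : ℝ) / 2) := Real.rpow_pos_of_pos hq0 _
  have hx0 : 0 < x := lt_of_lt_of_le hqx0 hx
  rw [Real.rpow_neg hx0.le, Real.rpow_neg hq0.le, Real.rpow_mul hq0.le]
  exact inv_anti₀ (Real.rpow_pos_of_pos hqx0 _) (Real.rpow_le_rpow hqx0.le hx ha)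

/-- `1 ≤ log η` for a Siegel zero (`η ≥ 10`). [folklore] -/
theorem one_le_log_eta {q : ℕ} [NeZero q] {χ : DirichletCharacter ℂ q} {η : ℝ} (h : IsSiegelZero χ η) :
    1 ≤ Real.log η := by
  rw [← Real.log_exp 1]
  refine Real.log_le_log (Real.exp_pos 1) (le_trans ?_ h.ten_le)
  have := Real.exp_one_lt_d9; linarith

/-- **`1/log^{1/10} η ≤ 1/log^{1/20} η`** for a Siegel zero. [folklore] -/
theorem inv_log_rpow_tenth_le {q : ℕ} [NeZero q] {χ : DirichletCharacter ℂ q} {η : ℝ} (h : IsSiegelZero χ η)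
    {K : ℝ} (hK : 0 ≤ K) : K / Real.log η ^ ((1 : ℝ) / 10) ≤ K / Real.log η ^ ((1 : ℝ) / 20) := by
  have hL1 := one_le_log_eta h
  refine div_le_div_of_nonneg_left hK (Real.rpow_pos_of_pos (by linarith) _) ?_
  exact Real.rpow_le_rpow_of_exponent_le hL1 (by norm_num)

/-- **`q^{-ε} ≤ K_ε / log^{1/20} η`** over Siegel zeros. [cite: TaoTeravainen2021, (1.4)] -/
theorem exists_rpow_neg_le_div_twentieth {ε : ℝ} (hε : 0 < ε) :
    ∃ K : ℝ, 0 ≤ K ∧ ∀ (q : ℕ) [NeZero q] (χ : DirichletCharacter ℂ q) (η : ℝ), IsSiegelZero χ η →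
      (q : ℝ) ^ (-ε) ≤ K / Real.log η ^ ((1 : ℝ) / 20) := by
  obtain ⟨K, hK0, hK⟩ := exists_rpow_neg_le_div hε
  exact ⟨K, hK0, fun q _ χ η h => (hK q χ η h).trans (inv_log_rpow_tenth_le h hK0)⟩

/-- **`(log q)^{-7/10} ≤ K / log^{1/20} η`** over Siegel zeros (`log η ≤ log q + c` by (1.4) with `ε = 1`).
[cite: TaoTeravainen2021, (1.4)] -/
theorem exists_log_conductor_rpow_neg_le :
    ∃ K : ℝ, 0 ≤ K ∧ ∀ (q : ℕ) [NeZero q] (χ : DirichletCharacter ℂ q) (η : ℝ), IsSiegelZero χ η →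
      Real.log q ^ (-(7 : ℝ) / 10) ≤ K / Real.log η ^ ((1 : ℝ) / 20) := by
  obtain ⟨c, hc⟩ := exists_log_le_mul_log_conductor_add one_pos
  -- `K = 2 (1 + |c|)`: if `log η ≥ 2|c|` then `log q ≥ log η/2`; otherwise `log η ≤ 2|c|` and the bound is crude
  refine ⟨2 * (1 + |c|), by positivity, fun q _ χ η h => ?_⟩
  have hq3 : (3 : ℝ) ≤ q := by exact_mod_cast h.three_le
  have hlogq : 1 ≤ Real.log q := by
    have h3 : Real.log 3 ≤ Real.log q := Real.log_le_log (by norm_num) hq3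
    have : 1 ≤ Real.log 3 := by
      rw [← Real.log_exp 1]
      refine Real.log_le_log (Real.exp_pos 1) ?_
      have := Real.exp_one_lt_d9; linarith
    linarith
  have hL1 := one_le_log_eta h
  have hL0 : 0 < Real.log η := by linarith
  have hcη := hc q χ η h
  rw [one_mul] at hcη
  -- `(log q)^{-7/10} ≤ (log q)^{-1/20}` and `(log η)^{1/20} ≤ …`
  have hpos20 : 0 < Real.log η ^ ((1 : ℝ) / 20) := Real.rpow_pos_of_pos hL0 _
  rw [le_div_iff₀ hpos20]
  have hq_mono : Real.log q ^ (-(7 : ℝ) / 10) ≤ Real.log q ^ (-(1 : ℝ) / 20) :=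
    Real.rpow_le_rpow_of_exponent_le hlogq (by norm_num)
  have hq20 : Real.log q ^ (-(1 : ℝ) / 20) = (Real.log q ^ ((1 : ℝ) / 20))⁻¹ := by
    rw [show (-(1 : ℝ) / 20) = -((1 : ℝ) / 20) by ring, Real.rpow_neg (by linarith)]
  have hq20pos : 0 < Real.log q ^ ((1 : ℝ) / 20) := Real.rpow_pos_of_pos (by linarith) _
  -- `(log η)^{1/20} ≤ (2 (1+|c|) log q)^{1/20} ≤ 2(1+|c|) (log q)^{1/20}`
  have hη_le : Real.log η ≤ 2 * (1 + |c|) * Real.log q := by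
    have := le_abs_self c
    nlinarith [abs_nonneg c]
  have h20 : Real.log η ^ ((1 : ℝ) / 20) ≤ 2 * (1 + |c|) * Real.log q ^ ((1 : ℝ) / 20) := by
    calc Real.log η ^ ((1 : ℝ) / 20) ≤ (2 * (1 + |c|) * Real.log q) ^ ((1 : ℝ) / 20) :=
          Real.rpow_le_rpow hL0.le hη_le (by norm_num)
      _ = (2 * (1 + |c|)) ^ ((1 : ℝ) / 20) * Real.log q ^ ((1 : ℝ) / 20) :=
          Real.mul_rpow (by positivity) (by linarith)
      _ ≤ (2 * (1 + |c|)) * Real.log q ^ ((1 : ℝ) / 20) := by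
          refine mul_le_mul_of_nonneg_right ?_ hq20pos.le
          have h1 : (1 : ℝ) ≤ 2 * (1 + |c|) := by have := abs_nonneg c; linarith
          calc (2 * (1 + |c|)) ^ ((1 : ℝ) / 20) ≤ (2 * (1 + |c|)) ^ (1 : ℝ) :=
                Real.rpow_le_rpow_of_exponent_le h1 (by norm_num)
            _ = 2 * (1 + |c|) := Real.rpow_one _
  calc Real.log q ^ (-(7 : ℝ) / 10) * Real.log η ^ ((1 : ℝ) / 20)
      ≤ Real.log q ^ (-(1 : ℝ) / 20) * (2 * (1 + |c|) * Real.log q ^ ((1 : ℝ) / 20)) :=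
        mul_le_mul hq_mono h20 hpos20.le (Real.rpow_nonneg (by linarith) _)
    _ = 2 * (1 + |c|) := by rw [hq20]; field_simp

end TaoTeravainen

end Literature.Barriers.Parity
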